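import Summits.QuantumFields.GaugeBoot.LatticeWords
import Literature.RepresentationTheory.CompactGroups.UnitaryTrick
import HarnessLib

/-!
# Gauge-boot: the edges read by a lattice word, and the holonomy when ONE link variable is replaced

Cell `ym-instrument` (HOME `run/shared/lean/pub/ym-instrument/`), crew (a), seat `ym-instrument-boot-lean-1`;
A-plan-11 «BESSEL CAP» typing, file 2/6 (the combinatorial tool). Builds on the word layer `LatticeWords`.

HONEST FRAMING (page 1 of every file of this cell): pure algebra of lattice words on the torus `(ℤ/L)^d` with
values in an arbitrary group; no measure, no expectation, nothing certified about any lattice gauge theory at any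
`(G, D, L, β)`; nothing summit-bearing.

## Content

* `Word.edgesRead x w`: the list of positively oriented torus edges traversed by the word `w` read from `x`
  (in order, with multiplicity); concatenation and reversal lemmas.
* A link variable NOT read by a word does not enter its holonomy
  (`wordHolonomy_update_of_not_mem`, via the tree's one-step formula `stepHolonomy_eq`).
* `Word.Split x w e`: a decomposition `w = w₁ · s · w₂` exhibiting that the edge `e` is read EXACTLY ONCE
  (by the step `s`, and by neither `w₁` nor `w₂`); it exists iff `(edgesRead x w).count e = 1`
  (`Word.nonempty_split_of_count_eq_one`), and then the holonomy with the link `e` replaced by `g` factorises as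
  `hol_x(w)(U[e ↦ g]) = A(U) · g^{±1} · B(U)` with `A, B` the holonomies of `w₁, w₂`, which do not read `e`
  (`Word.Split.wordHolonomy_update`).
* Trace form for a compact group with a continuous matrix representation `ρ`:
  `Re tr ρ(hol_x(w)(U[e ↦ g])) = Re tr ρ(g · staple)` with `staple = B A` (forward traversal) or `(B A)⁻¹`
  (backward traversal; `Re tr ρ(h⁻¹) = Re tr ρ(h)`), `Word.Split.re_trace_wordHolonomy_update`.
* The plaquette word: `edgesRead y (plaquette i j) = [(y,i), (y+eᵢ,j), (y+eⱼ,i), (y,j)]`, a list without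
  duplicates when `i ≠ j` and `L ≥ 2` (`Word.nodup_edgesRead_plaquette`), so every edge is read at most once by
  every plaquette (`Word.count_edgesRead_plaquette_le_one`).

These are the two facts the one-link heat-bath step of the a-priori Wilson-loop bound (Creutz, Phys. Rev. D 21
(1980) 2308, §III; file `BesselCap`) needs from the word calculus: the loop is affine in a once-traversed link, and
so is every plaquette of the action.
-/

namespace Summit.QuantumFields.GaugeBoot

open Literature.MathematicalPhysics.QuantumFieldTheory

variable {d L : ℕ}

namespace Word

/-! ## The edges read by a word -/

/-- The list of positively oriented edges traversed by the word `w` read from `x`, in order and with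
multiplicity (`Step.edge`). [folklore] -/
def edgesRead : Site d L → Word d → List (Edge d L)
  | _, [] => []
  | x, s :: w => s.edge x :: edgesRead (s.apply x) w

/-- Unfolding lemma `edgesRead_nil`. [folklore] -/
@[simp] theorem edgesRead_nil (x : Site d L) : edgesRead x ([] : Word d) = [] := rfl

/-- Unfolding lemma `edgesRead_cons`. [folklore] -/
@[simp] theorem edgesRead_cons (x : Site d L) (s : Step d) (w : Word d) :
    edgesRead x (s :: w) = s.edge x :: edgesRead (s.apply x) w := rfl

/-- The edges read by a concatenation. [folklore] -/
theorem edgesRead_append (x : Site d L) (v w : Word d) :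
    edgesRead x (v ++ w) = edgesRead x v ++ edgesRead (endpoint x v) w := by
  induction v generalizing x with
  | nil => rfl
  | cons s v ih => simp [ih]

/-- A word reads as many edges as it has steps. [folklore] -/
@[simp] theorem length_edgesRead (x : Site d L) (w : Word d) : (edgesRead x w).length = w.length := by
  induction w generalizing x with
  | nil => rfl
  | cons s w ih => simp [ih]

end Word

/-! ## Holonomies with one link variable replaced -/

section Update

variable {G : Type*} [Group G]

/-- A step not reading the edge `e` has the same holonomy after the link `e` is replaced. [folklore] -/
theorem stepHolonomy_update_of_ne (U : GaugeConfig d L G) (e : Edge d L) (g : G) (x : Site d L) (s : Step d)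
    (h : s.edge x ≠ e) : stepHolonomy (Function.update U e g) x s = stepHolonomy U x s := by
  rw [stepHolonomy_eq, stepHolonomy_eq, Function.update_of_ne h]

/-- The step reading the replaced edge carries `g` (forward) or `g⁻¹` (backward). [folklore] -/
theorem stepHolonomy_update_self (U : GaugeConfig d L G) (g : G) (x : Site d L) (s : Step d) :
    stepHolonomy (Function.update U (s.edge x) g) x s = if s.isFwd then g else g⁻¹ := by
  rw [stepHolonomy_eq, Function.update_self]

/-- **A word not reading `e` has the same holonomy after the link `e` is replaced.** [folklore] -/
theorem wordHolonomy_update_of_not_mem (U : GaugeConfig d L G) (e : Edge d L) (g : G) :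
    ∀ (x : Site d L) (w : Word d), e ∉ Word.edgesRead x w →
      wordHolonomy (Function.update U e g) x w = wordHolonomy U x w
  | x, [], _ => by simp
  | x, s :: w, h => by
    simp only [Word.edgesRead_cons, List.mem_cons, not_or] at h
    rw [wordHolonomy_cons, wordHolonomy_cons, stepHolonomy_update_of_ne U e g x s (Ne.symm h.1),
      wordHolonomy_update_of_not_mem U e g (s.apply x) w h.2]

end Update

namespace Word

/-! ## Reading an edge exactly once: the split `w = w₁ · s · w₂` -/

/-- A decomposition of the word `w` (read from `x`) as `w₁ ++ s :: w₂` in which the step `s` reads the edge `e`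
and neither `w₁` nor `w₂` does: the witness that `w` reads `e` exactly once. [folklore] -/
structure Split (x : Site d L) (w : Word d) (e : Edge d L) where
  /-- the prefix, not reading `e` -/
  pre : Word d
  /-- the step reading `e` -/
  step : Step d
  /-- the suffix, not reading `e` -/
  suf : Word d
  /-- the decomposition -/
  eq : w = pre ++ step :: suf
  /-- the prefix does not read `e` -/
  pre_not_mem : e ∉ edgesRead x pre
  /-- the step reads `e` -/
  step_edge : step.edge (endpoint x pre) = e
  /-- the suffix does not read `e` -/
  suf_not_mem : e ∉ edgesRead (step.apply (endpoint x pre)) suf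

/-- **A word reading the edge `e` exactly once splits at that step.** [folklore] -/
theorem nonempty_split_of_count_eq_one [DecidableEq (Edge d L)] (e : Edge d L) :
    ∀ (x : Site d L) (w : Word d), (edgesRead x w).count e = 1 → Nonempty (Split x w e)
  | x, [], h => by simp at h
  | x, s :: w, h => by
    rw [edgesRead_cons, List.count_cons] at h
    by_cases hs : s.edge x = e
    · -- the first step reads `e`; the rest does not
      have h0 : (edgesRead (s.apply x) w).count e = 0 := by
        rw [hs, beq_self_eq_true, if_pos rfl] at h; omega
      exact ⟨{
        pre := []
        step := s
        suf := w
        eq := rfl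
        pre_not_mem := by simp
        step_edge := hs
        suf_not_mem := List.not_mem_of_count_eq_zero h0 }⟩
    · have h1 : (edgesRead (s.apply x) w).count e = 1 := by
        have : (s.edge x == e) = false := beq_eq_false_iff_ne.mpr hs
        rw [this] at h; simpa using h
      obtain ⟨S⟩ := nonempty_split_of_count_eq_one e (s.apply x) w h1
      have hpre : e ∉ edgesRead x (s :: S.pre) := by
        simp only [edgesRead_cons, List.mem_cons, not_or]
        exact ⟨Ne.symm hs, S.pre_not_mem⟩
      exact ⟨{
        pre := s :: S.pre
        step := S.step
        suf := S.suf
        eq := by rw [List.cons_append]; exact congrArg (List.cons s) S.eq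
        pre_not_mem := hpre
        step_edge := by simpa using S.step_edge
        suf_not_mem := by simpa using S.suf_not_mem }⟩

/-- A chosen split of a word reading `e` exactly once. [folklore] -/
noncomputable def split [DecidableEq (Edge d L)] (x : Site d L) (w : Word d) (e : Edge d L)
    (h : (edgesRead x w).count e = 1) : Split x w e :=
  Classical.choice (nonempty_split_of_count_eq_one e x w h)

namespace Split

variable {x : Site d L} {w : Word d} {e : Edge d L} (S : Split x w e)

/-- The edges read by the whole word, through the split. [folklore] -/
theorem edgesRead_eq : edgesRead x w = edgesRead x S.pre ++ e :: edgesRead (S.step.apply (endpoint x S.pre)) S.suf := by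
  conv_lhs => rw [S.eq]
  rw [edgesRead_append, edgesRead_cons, S.step_edge]

/-- An edge not read by the word is read neither by the prefix … [folklore] -/
theorem not_mem_pre {e' : Edge d L} (h : e' ∉ edgesRead x w) : e' ∉ edgesRead x S.pre := by
  rw [S.edgesRead_eq] at h
  exact fun h' => h (List.mem_append_left _ h')

/-- … nor by the suffix. [folklore] -/
theorem not_mem_suf {e' : Edge d L} (h : e' ∉ edgesRead x w) :
    e' ∉ edgesRead (S.step.apply (endpoint x S.pre)) S.suf := by
  rw [S.edgesRead_eq] at h
  exact fun h' => h (List.mem_append_right _ (List.mem_cons_of_mem _ h'))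

variable {G : Type*} [Group G]

/-- The prefix holonomy `A(U) = hol_x(w₁)(U)`. [folklore] -/
def preHol (U : GaugeConfig d L G) : G := wordHolonomy U x S.pre

/-- The suffix holonomy `B(U) = hol(w₂)(U)` read from the endpoint of the step. [folklore] -/
def sufHol (U : GaugeConfig d L G) : G := wordHolonomy U (S.step.apply (endpoint x S.pre)) S.suf

/-- The prefix holonomy does not read `e`. [folklore] -/
theorem preHol_update (U : GaugeConfig d L G) (g : G) : S.preHol (Function.update U e g) = S.preHol U :=
  wordHolonomy_update_of_not_mem U e g x S.pre S.pre_not_mem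

/-- The suffix holonomy does not read `e`. [folklore] -/
theorem sufHol_update (U : GaugeConfig d L G) (g : G) : S.sufHol (Function.update U e g) = S.sufHol U :=
  wordHolonomy_update_of_not_mem U e g _ S.suf S.suf_not_mem

/-- The prefix holonomy does not read any edge the word does not read. [folklore] -/
theorem preHol_update_of_not_mem (U : GaugeConfig d L G) {e' : Edge d L} (h : e' ∉ edgesRead x w) (g : G) :
    S.preHol (Function.update U e' g) = S.preHol U :=
  wordHolonomy_update_of_not_mem U e' g x S.pre (S.not_mem_pre h)

/-- The suffix holonomy does not read any edge the word does not read. [folklore] -/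
theorem sufHol_update_of_not_mem (U : GaugeConfig d L G) {e' : Edge d L} (h : e' ∉ edgesRead x w) (g : G) :
    S.sufHol (Function.update U e' g) = S.sufHol U :=
  wordHolonomy_update_of_not_mem U e' g _ S.suf (S.not_mem_suf h)

/-- The holonomy of the word factorises through the split: `hol_x(w) = A · hol(s) · B`. [folklore] -/
theorem wordHolonomy_eq (U : GaugeConfig d L G) :
    wordHolonomy U x w = S.preHol U * stepHolonomy U (endpoint x S.pre) S.step * S.sufHol U := by
  conv_lhs => rw [S.eq]
  rw [wordHolonomy_append, wordHolonomy_cons, mul_assoc]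
  rfl

/-- **The word is affine in the once-read link**: `hol_x(w)(U[e ↦ g]) = A(U) · g^{±1} · B(U)`, the sign being the
orientation of the reading step. [folklore] -/
theorem wordHolonomy_update (U : GaugeConfig d L G) (g : G) :
    wordHolonomy (Function.update U e g) x w =
      S.preHol U * (if S.step.isFwd then g else g⁻¹) * S.sufHol U := by
  rw [S.wordHolonomy_eq, S.preHol_update, S.sufHol_update]
  congr 2
  have h := stepHolonomy_update_self U g (endpoint x S.pre) S.step
  rw [S.step_edge] at h
  exact h

/-- The STAPLE of the split: the group element `B A` (forward reading) or `(B A)⁻¹` (backward reading), chosen so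
that `Re tr ρ(hol_x(w)(U[e ↦ g])) = Re tr ρ(g · staple)`. [folklore] -/
noncomputable def staple (U : GaugeConfig d L G) : G :=
  if S.step.isFwd then S.sufHol U * S.preHol U else (S.sufHol U * S.preHol U)⁻¹

/-- The staple does not read `e`. [folklore] -/
theorem staple_update (U : GaugeConfig d L G) (g : G) : S.staple (Function.update U e g) = S.staple U := by
  simp only [staple, S.preHol_update, S.sufHol_update]

/-- The staple does not read any edge the word does not read. [folklore] -/
theorem staple_update_of_not_mem (U : GaugeConfig d L G) {e' : Edge d L} (h : e' ∉ edgesRead x w) (g : G) :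
    S.staple (Function.update U e' g) = S.staple U := by
  simp only [staple, S.preHol_update_of_not_mem U h, S.sufHol_update_of_not_mem U h]

variable {N : ℕ} [TopologicalSpace G] [IsTopologicalGroup G] [CompactSpace G] (ρ : G →* Matrix (Fin N) (Fin N) ℂ)

/-- **Trace form of the one-link dependence**: for a compact group and a continuous matrix representation,
`Re tr ρ(hol_x(w)(U[e ↦ g])) = Re tr ρ(g · staple(U))` (cyclicity of the trace, and `Re tr ρ(h⁻¹) = Re tr ρ(h)`
from the tree's unitary trick `CompactGroup.re_trace_map_inv`). [folklore] -/
theorem re_trace_wordHolonomy_update (hρ : Continuous ρ) (U : GaugeConfig d L G) (g : G) :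
    (ρ (wordHolonomy (Function.update U e g) x w)).trace.re = (ρ (g * S.staple U)).trace.re := by
  rw [S.wordHolonomy_update U g, staple]
  split_ifs with hf
  · -- `Re tr ρ(A g B) = Re tr ρ(g (B A))`: cyclicity of the trace
    simp only [map_mul]
    rw [Matrix.trace_mul_cycle (ρ (S.preHol U)) (ρ g) (ρ (S.sufHol U)), Matrix.trace_mul_comm (ρ g)]
  · -- `Re tr ρ(A g⁻¹ B) = Re tr ρ((A g⁻¹ B)⁻¹) = Re tr ρ(B⁻¹ (g A⁻¹)) = Re tr ρ(g A⁻¹ B⁻¹)`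
    have h1 : (ρ (S.preHol U * g⁻¹ * S.sufHol U)).trace.re =
        (ρ ((S.sufHol U)⁻¹ * (g * (S.preHol U)⁻¹))).trace.re := by
      rw [← Literature.RepresentationTheory.CompactGroups.CompactGroup.re_trace_map_inv ρ hρ
        (S.preHol U * g⁻¹ * S.sufHol U)]
      congr 3
      group
    rw [h1, show g * (S.sufHol U * S.preHol U)⁻¹ = (g * (S.preHol U)⁻¹) * (S.sufHol U)⁻¹ by group]
    simp only [map_mul]
    rw [Matrix.trace_mul_comm]

end Split

/-! ## The plaquette word reads four distinct edges -/

/-- The edges read by the plaquette word `+eᵢ +eⱼ −eᵢ −eⱼ` from `y`: bottom, right, top, left. [folklore] -/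
theorem edgesRead_plaquette (y : Site d L) (i j : Fin d) :
    edgesRead y (plaquette i j) = [(y, i), (y.shift i, j), (y.shift j, i), (y, j)] := by
  have h1 : (y.shift i).shift j - Pi.single i 1 = y.shift j := by
    simp only [Site.shift]; abel
  have h2 : y.shift j - Pi.single j 1 = y := by simp [Site.shift]
  simp [plaquette, edgesRead, Step.edge, Step.apply, h1, h2]

/-- For `i ≠ j` on a torus of side `L ≥ 2` the four edges of a plaquette are pairwise distinct. [folklore] -/
theorem nodup_edgesRead_plaquette (hL : 1 < L) (y : Site d L) {i j : Fin d} (hij : i ≠ j) :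
    (edgesRead y (plaquette i j)).Nodup := by
  haveI : Fact (1 < L) := ⟨hL⟩
  have hne : ∀ (z : Site d L) (k : Fin d), z.shift k ≠ z := by
    intro z k h
    have h' := congrFun h k
    simp [Site.shift] at h'
  have h12 : (y, i) ≠ (y.shift i, j) := fun h => hij (Prod.ext_iff.1 h).2
  have h13 : (y, i) ≠ (y.shift j, i) := fun h => hne y j (Prod.ext_iff.1 h).1.symm
  have h14 : (y, i) ≠ (y, j) := fun h => hij (Prod.ext_iff.1 h).2
  have h23 : (y.shift i, j) ≠ (y.shift j, i) := fun h => hij (Prod.ext_iff.1 h).2.symm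
  have h24 : (y.shift i, j) ≠ (y, j) := fun h => hne y i (Prod.ext_iff.1 h).1
  have h34 : (y.shift j, i) ≠ (y, j) := fun h => hij (Prod.ext_iff.1 h).2
  rw [edgesRead_plaquette]
  refine List.nodup_cons.2 ⟨?_, List.nodup_cons.2 ⟨?_, List.nodup_cons.2 ⟨?_, List.nodup_singleton _⟩⟩⟩
  · simp only [List.mem_cons, List.not_mem_nil, or_false, not_or]
    exact ⟨h12, h13, h14⟩
  · simp only [List.mem_cons, List.not_mem_nil, or_false, not_or]
    exact ⟨h23, h24⟩
  · simp only [List.mem_cons, List.not_mem_nil, or_false]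
    exact h34

/-- Hence every edge is read at most once by a plaquette word (`i ≠ j`, `L ≥ 2`). [folklore] -/
theorem count_edgesRead_plaquette_le_one [DecidableEq (Edge d L)] (hL : 1 < L) (y : Site d L) {i j : Fin d}
    (hij : i ≠ j) (e : Edge d L) : (edgesRead y (plaquette i j)).count e ≤ 1 :=
  List.nodup_iff_count_le_one.1 (nodup_edgesRead_plaquette hL y hij) e

end Word

end Summit.QuantumFields.GaugeBoot
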